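import Literature.AlgebraicGeometry.Frobenioids.UnitLinearPower
import Literature.AlgebraicGeometry.Frobenioids.CharacteristicSplittingProofs
import Literature.AlgebraicGeometry.Frobenioids.PullbackLinear
import HarnessLib

/-!
# Frobenioids I, proof of Proposition 2.5 (iii), step 2: `Ψ` on arrows out of isotropic objects

Mochizuki, *The geometry of Frobenioids I: the general theory*, Kyushu J. Math. **62** (2008)
293–400, §2, proof of Proposition 2.5 (iii), kurims text pp. 49–50
[cite: MochizukiFrdI2008, Prop. 2.5(iii) p.49].

Standing data: a Frobenioid `F : C → F_Φ` of Frobenius-normalized, metrically trivial and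
`Aut`-ample type, a characteristic splitting `τ`, an endomorphism `δ : Φ → Φ` ("multiplication by
`d`").  The text defines `Ψ(φ) := α ∘ Ψ(β) ∘ γ ∘ δ'` through a factorisation
`φ = α ∘ β ∘ γ ∘ δ'` (pull-back ∘ base-identity pre-step endomorphism ∘ isometric pre-step ∘
Frobenius type) and observes (p. 50): "by assertion (ii), it follows that if `φ ∈ Arr(C^istr)`, then
the morphism of Frobenius type `δ'` may be taken to be a base-identity endomorphism.  Thus, by the
functoriality of `τ` with respect to morphisms of `(C^istr)^lin`, and our assumption that `C` is of
Frobenius-normalized type … it follows that the assignment `φ ↦ Ψ(φ)` is compatible with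
composites, at least when `φ ∈ Arr(C^istr)`."

This file carries this out for arrows `φ : A → B` of `C` with `A` ISOTROPIC (then the isometric
pre-step `γ`, having isotropic domain, is an isomorphism and is absorbed):
* **normal form** `φ = ζ ; β ; α` with `ζ` a base-identity endomorphism of Frobenius type of `A`
  (`A` is Frobenius-trivial by Prop. 2.5 (ii)), `β ∈ O^▷(A)`, `α` a pull-back morphism
  (`exists_normalForm`), unique up to units of `O^▷(A)` (`normalForm_compare`);
* `unitLinearIstr … φ := ζ ; Ψ_A(β) ; α` (`Ψ_A` from `UnitLinearPower.lean`), independent of the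
  normal form (`unitLinearIstr_eq`), with `Base`, `deg_Fr` unchanged and `Div` multiplied by `δ`,
  the identity on isometries, COMPATIBLE WITH COMPOSITES (`unitLinearIstr_comp`: lift `ζ'` along the
  pull-back `α` [Prop. 1.11 (iii), Remark 1.11.1], move `β` past it by Frobenius-normalisation, move
  `β'` past `α` by naturality of `Ψ` [Prop. 1.11 (iv)]), injective when `δ` is and surjective onto
  the arrows with divisor in `d · Φ`.
Composition is diagrammatic; `O^▷(A) ⊆ End A` multiplies by `f * g = g ≫ f`.
-/

noncomputable section

namespace Literature.AlgebraicGeometry.Frobenioids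

open CategoryTheory Opposite

universe w v v' u u'

namespace PreFrobenioid

variable {D : Type u} [Category.{v} D] {Φ : Dᵒᵖ ⥤ CommMonCat.{w}}
  {C : Type u'} [Category.{v'} C] {F : C ⥤ ElemFrobenioid Φ}

/-! ### Normal forms `ζ ; β ; α` of arrows out of an isotropic object -/

/-- Products in `O^▷(A) ⊆ End A` as composites: `(a · b · c) = c ; b ; a`.
[cite: MochizukiFrdI2008, Def. 1.2(ii) p.22] -/
theorem endSubmonoid_coe_mul_mul {A : C} (a b c : endSubmonoid F A) :
    ((a * b * c).1 : A ⟶ A) = (c.1 : A ⟶ A) ≫ (b.1 : A ⟶ A) ≫ (a.1 : A ⟶ A) := by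
  rw [Submonoid.coe_mul, Submonoid.coe_mul, End.mul_def, End.mul_def]

/-- Powers in `O^▷(A) ⊆ End A`. [cite: MochizukiFrdI2008, Def. 1.2(ii) p.22] -/
theorem endSubmonoid_coe_pow {A : C} (a : endSubmonoid F A) (n : ℕ) :
    ((a ^ n).1 : End A) = (a.1 : End A) ^ n :=
  SubmonoidClass.coe_pow a n

/-- `Div` of a normal form: `Div(ζ ; x ; α) = Div(x)` for `ζ` a base-identity isometry, `x ∈ O^▷(A)`
and `α` a linear isometry (Remark 1.1.1). [cite: MochizukiFrdI2008, Prop. 2.5(iii) p.49] -/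
theorem div_normalForm {A B : C} {ζ : A ⟶ A} (hζb : IsBaseIdentity F ζ) (hζi : IsIsometry F ζ)
    (x : endSubmonoid F A) {α : A ⟶ B} (hαi : IsIsometry F α) (hαl : IsLinear F α) :
    Div F (ζ ≫ (x.1 : A ⟶ A) ≫ α) = divHom F A x := by
  rw [div_comp, div_comp, show Base F ζ = 𝟙 _ from hζb, pull_id, show Div F ζ = 1 from hζi, one_pow,
    mul_one, show Base F (x.1 : A ⟶ A) = 𝟙 _ from x.2.1, pull_id, show Div F α = 1 from hαi, one_mul,
    show degFr F α = 1 from hαl, PNat.one_coe, pow_one, divHom_apply]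

/-- `Base` of a normal form: `Base(ζ ; x ; α) = Base(α)`. [cite: MochizukiFrdI2008, Prop. 2.5(iii) p.49] -/
theorem base_normalForm {A B : C} {ζ : A ⟶ A} (hζb : IsBaseIdentity F ζ) (x : endSubmonoid F A)
    (α : A ⟶ B) : Base F (ζ ≫ (x.1 : A ⟶ A) ≫ α) = Base F α := by
  rw [base_comp, base_comp, show Base F ζ = 𝟙 _ from hζb, show Base F (x.1 : A ⟶ A) = 𝟙 _ from x.2.1,
    Category.id_comp, Category.id_comp]

/-- `deg_Fr` of a normal form: `deg_Fr(ζ ; x ; α) = deg_Fr(ζ)` for `α` linear.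
[cite: MochizukiFrdI2008, Prop. 2.5(iii) p.49] -/
theorem degFr_normalForm {A B : C} (ζ : A ⟶ A) (x : endSubmonoid F A) {α : A ⟶ B}
    (hαl : IsLinear F α) : degFr F (ζ ≫ (x.1 : A ⟶ A) ≫ α) = degFr F ζ := by
  rw [degFr_comp, degFr_comp, show degFr F (x.1 : A ⟶ A) = 1 from x.2.2, show degFr F α = 1 from hαl,
    mul_one, mul_one]

/-- **Normal form.** In a Frobenioid of metrically trivial and `Aut`-ample type, every arrow
`φ : A → B` with `A` isotropic is `φ = ζ ; β ; α` with `ζ` a base-identity endomorphism of Frobenius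
type (`A` is Frobenius-trivial, Prop. 2.5 (ii)), `β ∈ O^▷(A)` and `α` a pull-back morphism: factor
`φ` by Def. 1.3 (iv)(a), replace the Frobenius-type part by `ζ_A(n)` (Def. 1.3 (ii)), and turn the
pre-step part, whose codomain is isomorphic to `A` (metric triviality), into a base-identity
endomorphism by an automorphism of `A` over the discrepancy of bases (`Aut`-ampleness).
[cite: MochizukiFrdI2008, Prop. 2.5(iii) p.49] -/
theorem exists_normalForm (hF : IsFrobenioid F) (hmt : IsOfType (IsMetricallyTrivial F))
    (haa : IsOfType (IsAutAmple F)) {A B : C} (hA : IsIsotropic F A) (φ : A ⟶ B) :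
    ∃ (ζ : A ⟶ A) (β : endSubmonoid F A) (α : A ⟶ B), IsBaseIdentity F ζ ∧ IsFrobeniusType F ζ ∧
      IsPullbackMorphism F α ∧ ζ ≫ (β.1 : A ⟶ A) ≫ α = φ := by
  have hP := hF.isPreFrobenioid
  obtain ⟨X, Y, γ, p, α₀, hfac, hγ, hp, hα₀⟩ := hF.iv_a_exists φ
  -- `A` is Frobenius-trivial (Prop. 2.5 (ii)); replace `γ` by `ζ_A(n)`
  have hft : IsFrobeniusTrivial F A :=
    (isFrobeniusTrivial_istr_iff hF ⟨A, hA⟩).mp (isOfType_isFrobeniusTrivial_istr hF hmt ⟨A, hA⟩)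
  obtain ⟨z, hz⟩ := hft
  obtain ⟨hzd, hzb, hzf⟩ := hz (degFr F γ)
  obtain ⟨e, he⟩ := hF.ii_unique (z (degFr F γ) : A ⟶ A) γ hzf hγ hzd
  -- the pre-step `e ; p : A → Y` has codomain isomorphic to `A`; fix the base by `Aut`-ampleness
  have hq : IsPreStep F (e.hom ≫ p) := IsPreStep.comp F (isPreStep_of_isIso F e.hom) hp
  have hqco : IsCoAngular F (e.hom ≫ p) :=
    isCoAngular_of_isIsotropic_codomains F _ fun _ g => hF.vii_b g hA
  obtain ⟨f₀⟩ := hmt A (e.hom ≫ p) hqco hq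
  obtain ⟨a, ha⟩ := haa A (@asIso D _ _ _ (Base F ((e.hom ≫ p) ≫ f₀.hom))
    (IsBaseIso.comp F hq.2 (isBaseIso_of_isIso F f₀.hom)))
  have hab : Base F a.hom = Base F ((e.hom ≫ p) ≫ f₀.hom) := congrArg Iso.hom ha
  refine ⟨z (degFr F γ), ⟨((e.hom ≫ p) ≫ f₀.hom) ≫ a.inv, ?_, ?_⟩, a.hom ≫ f₀.inv ≫ α₀, hzb, hzf,
    ?_, ?_⟩
  · show Base F (((e.hom ≫ p) ≫ f₀.hom) ≫ a.inv) = 𝟙 _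
    rw [base_comp, ← hab, ← base_comp, a.hom_inv_id, base_id]
  · exact IsLinear.comp F (IsLinear.comp F hq.1 (isLinear_of_isIso F f₀.hom)) (isLinear_of_isIso F a.inv)
  · exact IsPullbackMorphism.comp F (isPullbackMorphism_of_isIso F a.hom)
      (IsPullbackMorphism.comp F (isPullbackMorphism_of_isIso F f₀.inv) hα₀)
  · show (z (degFr F γ) : A ⟶ A) ≫ ((((e.hom ≫ p) ≫ f₀.hom) ≫ a.inv) ≫ a.hom ≫ f₀.inv ≫ α₀) = φ
    simp only [Category.assoc, Iso.inv_hom_id_assoc, Iso.hom_inv_id_assoc]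
    rw [← hfac, reassoc_of% he]

/-- Two pull-back morphisms `α, α' : A → B` over the same arrow of `D` differ by a unit of `O^▷(A)`:
`α' = w ; α` (Def. 1.2 (ii)). [cite: MochizukiFrdI2008, Prop. 2.5(iii) p.49] -/
theorem exists_unit_of_isPullbackMorphism_base_eq (hF : IsFrobenioid F) {A B : C} {α α' : A ⟶ B}
    (hα : IsPullbackMorphism F α) (hα' : IsPullbackMorphism F α') (hb : Base F α = Base F α') :
    ∃ w : endSubmonoid F A, IsUnit w ∧ α' = (w.1 : A ⟶ A) ≫ α := by
  obtain ⟨w, hw, hwb⟩ := hα.exists_lift α' (𝟙 _) (by rw [Category.id_comp, hb])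
  obtain ⟨w', hw', hw'b⟩ := hα'.exists_lift α (𝟙 _) (by rw [Category.id_comp, hb])
  have h1 : w' ≫ w = 𝟙 _ :=
    hα.hom_ext (by rw [Category.assoc, hw, hw', Category.id_comp])
      (by rw [base_comp, hwb, hw'b, Category.id_comp, base_id])
  have h2 : w ≫ w' = 𝟙 _ :=
    hα'.hom_ext (by rw [Category.assoc, hw', hw, Category.id_comp])
      (by rw [base_comp, hwb, hw'b, Category.id_comp, base_id])
  have hwlin : IsLinear F w :=
    (isLinear_factors F (show IsLinear F (w ≫ α) by rw [hw]; exact (hF.iv_b α' hα').2)).2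
  have hw'lin : IsLinear F w' :=
    (isLinear_factors F (show IsLinear F (w' ≫ α') by rw [hw']; exact (hF.iv_b α hα).2)).2
  refine ⟨⟨w, hwb, hwlin⟩, ⟨⟨⟨w, hwb, hwlin⟩, ⟨w', hw'b, hw'lin⟩, Subtype.ext h1, Subtype.ext h2⟩, rfl⟩,
    hw.symm⟩

/-- Two base-identity endomorphisms of Frobenius type of the same degree differ by a unit of `O^▷(A)`:
`ζ' = ζ ; v` (Def. 1.3 (ii)). [cite: MochizukiFrdI2008, Prop. 2.5(iii) p.49] -/
theorem exists_unit_of_isFrobeniusType_degFr_eq (hF : IsFrobenioid F) {A : C} {ζ ζ' : A ⟶ A}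
    (hζb : IsBaseIdentity F ζ) (hζ : IsFrobeniusType F ζ) (hζ'b : IsBaseIdentity F ζ')
    (hζ' : IsFrobeniusType F ζ') (hd : degFr F ζ = degFr F ζ') :
    ∃ v : endSubmonoid F A, IsUnit v ∧ ζ' = ζ ≫ (v.1 : A ⟶ A) := by
  obtain ⟨e, he⟩ := hF.ii_unique ζ ζ' hζ hζ' hd
  have heb : Base F e.hom = 𝟙 _ := by
    have h := congrArg (Base F) he
    rw [base_comp, show Base F ζ = 𝟙 _ from hζb, show Base F ζ' = 𝟙 _ from hζ'b,
      Category.id_comp] at h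
    exact h
  have heb' : Base F e.inv = 𝟙 _ := by
    have h1 : Base F e.hom ≫ Base F e.inv = 𝟙 _ := by rw [← base_comp, e.hom_inv_id, base_id]
    rwa [heb, Category.id_comp] at h1
  refine ⟨⟨e.hom, heb, isLinear_of_isIso F e.hom⟩,
    ⟨⟨⟨e.hom, heb, isLinear_of_isIso F e.hom⟩, ⟨e.inv, heb', isLinear_of_isIso F e.inv⟩,
      Subtype.ext e.inv_hom_id, Subtype.ext e.hom_inv_id⟩, rfl⟩, he.symm⟩

/-- **Uniqueness of normal forms up to units.** If `ζ ; x ; α = ζ' ; x' ; α'` with `ζ, ζ'`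
base-identity of Frobenius type of the same degree, `x, x' ∈ O^▷(A)` and `α, α'` pull-back morphisms
over the same arrow of `D`, then `ζ' = ζ ; v`, `α' = w ; α` and `x = w · x' · v` for units `v, w` of
`O^▷(A)` ("this factorization is unique … up to …", p. 49; `ζ` is an epimorphism and `α` is injective
on arrows with the same base). [cite: MochizukiFrdI2008, Prop. 2.5(iii) p.49] -/
theorem normalForm_compare (hF : IsFrobenioid F) {A B : C} {ζ ζ' : A ⟶ A} {x x' : endSubmonoid F A}
    {α α' : A ⟶ B} (hζb : IsBaseIdentity F ζ) (hζ : IsFrobeniusType F ζ) (hζ'b : IsBaseIdentity F ζ')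
    (hζ' : IsFrobeniusType F ζ') (hd : degFr F ζ = degFr F ζ') (hα : IsPullbackMorphism F α)
    (hα' : IsPullbackMorphism F α') (hb : Base F α = Base F α')
    (h : ζ ≫ (x.1 : A ⟶ A) ≫ α = ζ' ≫ (x'.1 : A ⟶ A) ≫ α') :
    ∃ v w : endSubmonoid F A, IsUnit v ∧ IsUnit w ∧ ζ' = ζ ≫ (v.1 : A ⟶ A) ∧
      α' = (w.1 : A ⟶ A) ≫ α ∧ x = w * x' * v := by
  obtain ⟨v, hv, hζv⟩ := exists_unit_of_isFrobeniusType_degFr_eq hF hζb hζ hζ'b hζ' hd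
  obtain ⟨w, hw, hαw⟩ := exists_unit_of_isPullbackMorphism_base_eq hF hα hα' hb
  refine ⟨v, w, hv, hw, hζv, hαw, ?_⟩
  haveI := hF.isPreFrobenioid.isTotallyEpimorphic.epi ζ
  apply Subtype.ext
  rw [endSubmonoid_coe_mul_mul]
  apply (cancel_epi ζ).mp
  apply hα.hom_ext
  · rw [Category.assoc, h, hζv, hαw]
    simp only [Category.assoc]
  · simp only [base_comp, show Base F ζ = 𝟙 _ from hζb, show Base F (x.1 : A ⟶ A) = 𝟙 _ from x.2.1,
      show Base F (x'.1 : A ⟶ A) = 𝟙 _ from x'.2.1, show Base F (v.1 : A ⟶ A) = 𝟙 _ from v.2.1,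
      show Base F (w.1 : A ⟶ A) = 𝟙 _ from w.2.1, Category.id_comp]

/-! ### `Ψ` on arrows out of isotropic objects -/

namespace CharacteristicSplitting

variable (hF : IsFrobenioid F) (τ : CharacteristicSplitting F) (hmt : IsOfType (IsMetricallyTrivial F))
  (haa : IsOfType (IsAutAmple F)) (δ : Φ ⟶ Φ)

/-- **`Ψ(φ) := ζ ; Ψ_A(β) ; α`** for an arrow `φ = ζ ; β ; α : A → B` out of an isotropic object
(a chosen normal form; `Ψ_A = unitLinearPow`). [cite: MochizukiFrdI2008, Prop. 2.5(iii) p.49] -/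
def unitLinearIstr {A B : C} (hA : IsIsotropic F A) (φ : A ⟶ B) : A ⟶ B :=
  (exists_normalForm hF hmt haa hA φ).choose ≫
    ((unitLinearPow hF τ hmt haa δ A (exists_normalForm hF hmt haa hA φ).choose_spec.choose).1 : A ⟶ A) ≫
      (exists_normalForm hF hmt haa hA φ).choose_spec.choose_spec.choose

/-- Unfolding `unitLinearIstr` along its chosen normal form. [cite: MochizukiFrdI2008, Prop. 2.5(iii) p.49] -/
theorem unitLinearIstr_def {A B : C} (hA : IsIsotropic F A) (φ : A ⟶ B) :
    ∃ (ζ : A ⟶ A) (β : endSubmonoid F A) (α : A ⟶ B), IsBaseIdentity F ζ ∧ IsFrobeniusType F ζ ∧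
      IsPullbackMorphism F α ∧ ζ ≫ (β.1 : A ⟶ A) ≫ α = φ ∧
        unitLinearIstr hF τ hmt haa δ hA φ = ζ ≫ ((unitLinearPow hF τ hmt haa δ A β).1 : A ⟶ A) ≫ α :=
  ⟨_, _, _, (exists_normalForm hF hmt haa hA φ).choose_spec.choose_spec.choose_spec.1,
    (exists_normalForm hF hmt haa hA φ).choose_spec.choose_spec.choose_spec.2.1,
    (exists_normalForm hF hmt haa hA φ).choose_spec.choose_spec.choose_spec.2.2.1,
    (exists_normalForm hF hmt haa hA φ).choose_spec.choose_spec.choose_spec.2.2.2, rfl⟩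

/-- Units pass through `Ψ_A` inside a triple product: `Ψ_A(w · x · v) = w · Ψ_A(x) · v`.
[cite: MochizukiFrdI2008, Prop. 2.5(iii) p.50] -/
theorem unitLinearPow_unit_mul_mul_unit {A : C} {v w : endSubmonoid F A} (hv : IsUnit v) (hw : IsUnit w)
    (x : endSubmonoid F A) :
    unitLinearPow hF τ hmt haa δ A (w * x * v) =
      w * unitLinearPow hF τ hmt haa δ A x * v := by
  rw [unitLinearPow_mul, unitLinearPow_mul, unitLinearPow_of_isUnit hF τ hmt haa δ hv,
    unitLinearPow_of_isUnit hF τ hmt haa δ hw]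

/-- **`Ψ(φ)` is independent of the normal form**: for ANY `φ = ζ ; β ; α` as above,
`Ψ(φ) = ζ ; Ψ_A(β) ; α` (two normal forms differ by units `v, w` of `O^▷(A)`, and
`Ψ_A(w · β' · v) = w · Ψ_A(β') · v`). [cite: MochizukiFrdI2008, Prop. 2.5(iii) p.50] -/
theorem unitLinearIstr_eq {A B : C} (hA : IsIsotropic F A) {φ : A ⟶ B} {ζ : A ⟶ A}
    {β : endSubmonoid F A} {α : A ⟶ B} (hζb : IsBaseIdentity F ζ) (hζ : IsFrobeniusType F ζ)
    (hα : IsPullbackMorphism F α) (h : ζ ≫ (β.1 : A ⟶ A) ≫ α = φ) :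
    unitLinearIstr hF τ hmt haa δ hA φ = ζ ≫ ((unitLinearPow hF τ hmt haa δ A β).1 : A ⟶ A) ≫ α := by
  obtain ⟨ζ₀, β₀, α₀, hζ₀b, hζ₀, hα₀, h₀, hΨ⟩ := unitLinearIstr_def hF τ hmt haa δ hA φ
  rw [hΨ]
  have hd : degFr F ζ₀ = degFr F ζ := by
    rw [← degFr_normalForm ζ₀ β₀ (hF.iv_b α₀ hα₀).2, ← degFr_normalForm ζ β (hF.iv_b α hα).2, h₀, h]
  have hb : Base F α₀ = Base F α := by
    rw [← base_normalForm hζ₀b β₀ α₀, ← base_normalForm hζb β α, h₀, h]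
  obtain ⟨v, w, hv, hw, hζv, hαw, hx⟩ :=
    normalForm_compare hF hζ₀b hζ₀ hζb hζ hd hα₀ hα hb (h₀.trans h.symm)
  rw [hx, unitLinearPow_unit_mul_mul_unit hF τ hmt haa δ hv hw, endSubmonoid_coe_mul_mul, hζv, hαw]
  simp only [Category.assoc]

/-- `Base(Ψ(φ)) = Base(φ)`. [cite: MochizukiFrdI2008, Prop. 2.5(iii) p.49] -/
theorem base_unitLinearIstr {A B : C} (hA : IsIsotropic F A) (φ : A ⟶ B) :
    Base F (unitLinearIstr hF τ hmt haa δ hA φ) = Base F φ := by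
  obtain ⟨ζ, β, α, hζb, hζ, hα, h⟩ := exists_normalForm hF hmt haa hA φ
  rw [unitLinearIstr_eq hF τ hmt haa δ hA hζb hζ hα h, ← h, base_normalForm hζb, base_normalForm hζb]

/-- `deg_Fr(Ψ(φ)) = deg_Fr(φ)`. [cite: MochizukiFrdI2008, Prop. 2.5(iii) p.49] -/
theorem degFr_unitLinearIstr {A B : C} (hA : IsIsotropic F A) (φ : A ⟶ B) :
    degFr F (unitLinearIstr hF τ hmt haa δ hA φ) = degFr F φ := by
  obtain ⟨ζ, β, α, hζb, hζ, hα, h⟩ := exists_normalForm hF hmt haa hA φ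
  rw [unitLinearIstr_eq hF τ hmt haa δ hA hζb hζ hα h, ← h, degFr_normalForm ζ _ (hF.iv_b α hα).2,
    degFr_normalForm ζ _ (hF.iv_b α hα).2]

/-- **`Div(Ψ(φ)) = d · Div(φ)`** (compatibility with the Frobenius functor on `F_Φ`).
[cite: MochizukiFrdI2008, Prop. 2.5(iii) p.49] -/
theorem div_unitLinearIstr {A B : C} (hA : IsIsotropic F A) (φ : A ⟶ B) :
    Div F (unitLinearIstr hF τ hmt haa δ hA φ) = (δ.app (op (baseObj F A))).hom (Div F φ) := by
  obtain ⟨ζ, β, α, hζb, hζ, hα, h⟩ := exists_normalForm hF hmt haa hA φ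
  obtain ⟨⟨-, hαi⟩, hαl⟩ := hF.iv_b α hα
  rw [unitLinearIstr_eq hF τ hmt haa δ hA hζb hζ hα h, ← h, div_normalForm hζb hζ.1.2 _ hαi hαl,
    div_normalForm hζb hζ.1.2 _ hαi hαl, div_unitLinearPow]

/-- `Ψ(φ)` lies in `C(d)`. [cite: MochizukiFrdI2008, Prop. 2.5(iii) p.49] -/
theorem div_unitLinearIstr_mem {A B : C} (hA : IsIsotropic F A) (φ : A ⟶ B) :
    Div F (unitLinearIstr hF τ hmt haa δ hA φ) ∈ imageSubmonoid δ (op (baseObj F A)) :=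
  ⟨Div F φ, (div_unitLinearIstr hF τ hmt haa δ hA φ).symm⟩

/-- **`Ψ` is the identity on isometries**: if `Div(φ) = 0` then `β` is a unit of `O^▷(A)`
(Prop. 2.2 (iii)) and `Ψ_A(β) = β`. [cite: MochizukiFrdI2008, Prop. 2.5(iii) p.49] -/
theorem unitLinearIstr_of_isIsometry {A B : C} (hA : IsIsotropic F A) {φ : A ⟶ B}
    (hφ : IsIsometry F φ) : unitLinearIstr hF τ hmt haa δ hA φ = φ := by
  obtain ⟨ζ, β, α, hζb, hζ, hα, h⟩ := exists_normalForm hF hmt haa hA φ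
  obtain ⟨⟨-, hαi⟩, hαl⟩ := hF.iv_b α hα
  have hβ : IsUnit β := by
    rw [← associated_one_iff_isUnit, ← div_eq_div_iff_associated F hF, map_one,
      ← div_normalForm hζb hζ.1.2 β hαi hαl, h]
    exact hφ
  rw [unitLinearIstr_eq hF τ hmt haa δ hA hζb hζ hα h, unitLinearPow_of_isUnit hF τ hmt haa δ hβ, h]

/-- `Ψ` on an element `β ∈ O^▷(A)` (normal form `id ; β ; id`) is `Ψ_A(β)`.
[cite: MochizukiFrdI2008, Prop. 2.5(iii) p.49] -/
theorem unitLinearIstr_endSubmonoid {A : C} (hA : IsIsotropic F A) (β : endSubmonoid F A) :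
    unitLinearIstr hF τ hmt haa δ hA (β.1 : A ⟶ A) = (unitLinearPow hF τ hmt haa δ A β).1 := by
  rw [unitLinearIstr_eq hF τ hmt haa δ hA (ζ := 𝟙 A) (β := β) (α := 𝟙 A) (base_id F A)
    (isFrobeniusType_of_isIso F hF.isPreFrobenioid (𝟙 A)) (isPullbackMorphism_of_isIso F (𝟙 A))
    (by rw [Category.id_comp, Category.comp_id]), Category.id_comp, Category.comp_id]

/-! ### Compatibility with composites -/

/-- A base-identity endomorphism of Frobenius type `ζ'` of `B` lifts along a pull-back morphism
`α : A → B` to one of `A` of the same degree: `α ; ζ' = ζ'' ; α` (Prop. 1.11 (iii), Remark 1.11.1).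
[cite: MochizukiFrdI2008, Rem. 1.11.1 p.38] -/
theorem exists_frobeniusType_lift (hF : IsFrobenioid F) {A B : C} {α : A ⟶ B}
    (hα : IsPullbackMorphism F α) {ζ' : B ⟶ B} (hζ'b : IsBaseIdentity F ζ') (hζ' : IsFrobeniusType F ζ') :
    ∃ ζ'' : A ⟶ A, IsBaseIdentity F ζ'' ∧ IsFrobeniusType F ζ'' ∧ degFr F ζ'' = degFr F ζ' ∧
      α ≫ ζ' = ζ'' ≫ α := by
  obtain ⟨ζ'', ⟨hb, hsq⟩, -⟩ := existsUnique_endo_lift hα ζ' (𝟙 _)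
    (by rw [show Base F ζ' = 𝟙 _ from hζ'b, Category.comp_id, Category.id_comp])
  have hft : IsFrobeniusType F ζ'' := isFrobeniusType_endo_lift hF hα hζ' hsq
    (by show IsIso (Base F ζ''); rw [hb]; infer_instance)
  refine ⟨ζ'', hb, hft, ?_, hsq⟩
  have hd := congrArg (degFr F) hsq
  rw [degFr_comp, degFr_comp, (hF.iv_b α hα).2, one_mul, mul_one] at hd
  exact hd.symm

/-- Frobenius-normalisation in `O^▷(A)`: `x ; ζ = ζ ; x^n` for `ζ` base-identity of degree `n`.
[cite: MochizukiFrdI2008, Def. 1.2(iv) p.23] -/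
theorem comp_eq_comp_pow_of_isFrobeniusNormalized {A : C} (hn : IsFrobeniusNormalized F A)
    {ζ : A ⟶ A} (hζb : IsBaseIdentity F ζ) (x : endSubmonoid F A) :
    (x.1 : A ⟶ A) ≫ ζ = ζ ≫ ((x ^ (degFr F ζ : ℕ)).1 : A ⟶ A) := by
  have h := hn ζ hζb x.1 x.2
  dsimp only at h
  rw [endSubmonoid_coe_pow]
  exact h.symm

/-- **`Ψ` is compatible with composites** on arrows out of isotropic objects: for `φ : A → B`,
`φ' : B → B'` with `A` (hence `B`) isotropic, `Ψ(φ ; φ') = Ψ(φ) ; Ψ(φ')`.  With normal forms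
`φ = ζ ; β ; α`, `φ' = ζ' ; β' ; α'`: lift `ζ'` along `α` (`α ; ζ' = ζ'' ; α`), move `β` past `ζ''`
(`β ; ζ'' = ζ'' ; β^m`, Frobenius-normalisation) and `β'` past `α` (`α ; β' = β'' ; α`, Prop. 1.11
(iv)); then `φ ; φ' = (ζ ; ζ'') ; (β'' · β^m) ; (α ; α')` is a normal form, and `Ψ_A` is multiplicative,
natural along `α` and its values are again Frobenius-normalised.
[cite: MochizukiFrdI2008, Prop. 2.5(iii) p.50] -/
theorem unitLinearIstr_comp (hnorm : IsOfType (IsFrobeniusNormalized F)) {A B B' : C}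
    (hA : IsIsotropic F A) (φ : A ⟶ B) (φ' : B ⟶ B') :
    unitLinearIstr hF τ hmt haa δ hA (φ ≫ φ') =
      unitLinearIstr hF τ hmt haa δ hA φ ≫ unitLinearIstr hF τ hmt haa δ (hF.vii_b φ hA) φ' := by
  have hB : IsIsotropic F B := hF.vii_b φ hA
  obtain ⟨ζ, β, α, hζb, hζ, hα, h⟩ := exists_normalForm hF hmt haa hA φ
  obtain ⟨ζ', β', α', hζ'b, hζ', hα', h'⟩ := exists_normalForm hF hmt haa hB φ'
  -- lift `ζ'` along `α`
  obtain ⟨ζ'', hζ''b, hζ'', hdeg, hsq⟩ := exists_frobeniusType_lift hF hα hζ'b hζ'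
  -- move `β'` and `Ψ_B(β')` past `α`
  have hαco : IsCoAngular F α := isCoAngular_of_isIsotropic_codomains F α fun _ g => hF.vii_b g hA
  have hαl : IsLinear F α := (hF.iv_b α hα).2
  obtain ⟨β'', hβ''⟩ := exists_endSubmonoid_intertwiner hF hαco hαl β'
  have hΨβ'' := unitLinearPow_natural hF τ hmt haa δ hA hαl hβ''
  -- normal form of the composite
  have hnf : (ζ ≫ ζ'') ≫ ((β'' * β ^ (degFr F ζ'' : ℕ)).1 : A ⟶ A) ≫ (α ≫ α') = φ ≫ φ' := by
    rw [← h, ← h', Submonoid.coe_mul, End.mul_def]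
    simp only [Category.assoc]
    rw [reassoc_of% hsq, reassoc_of% hβ'',
      reassoc_of% (comp_eq_comp_pow_of_isFrobeniusNormalized (hnorm A) hζ''b β)]
  have hbζ : IsBaseIdentity F (ζ ≫ ζ'') := by
    show Base F (ζ ≫ ζ'') = 𝟙 _
    rw [base_comp, show Base F ζ = 𝟙 _ from hζb, show Base F ζ'' = 𝟙 _ from hζ''b, Category.id_comp]
  rw [unitLinearIstr_eq hF τ hmt haa δ hA hζb hζ hα h, unitLinearIstr_eq hF τ hmt haa δ hB hζ'b hζ' hα' h',
    unitLinearIstr_eq hF τ hmt haa δ hA hbζ (IsFrobeniusType.comp F hF hζ hζ'')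
      (IsPullbackMorphism.comp F hα hα') hnf,
    unitLinearPow_mul, unitLinearPow_pow, Submonoid.coe_mul, End.mul_def]
  -- right-hand side: `ζ ; Ψβ ; α ; ζ' ; Ψβ' ; α' = ζ ; ζ'' ; (Ψβ)^m ; Ψβ'' ; α ; α'`
  simp only [Category.assoc]
  rw [reassoc_of% hsq, reassoc_of% hΨβ'',
    reassoc_of% (comp_eq_comp_pow_of_isFrobeniusNormalized (hnorm A) hζ''b
      (unitLinearPow hF τ hmt haa δ A β))]

/-! ### `Ψ` is injective and hits `C(d)` -/

/-- **`Ψ` is injective on arrows out of an isotropic object** when `δ` is injective: equal values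
have equal degrees and bases; comparing normal forms (`normalForm_compare`) reduces to the
injectivity of `Ψ_A`. [cite: MochizukiFrdI2008, Prop. 2.5(iii) p.50] -/
theorem unitLinearIstr_injective {A B : C} (hA : IsIsotropic F A)
    (hδ : Function.Injective (δ.app (op (baseObj F A))).hom) {φ φ' : A ⟶ B}
    (h : unitLinearIstr hF τ hmt haa δ hA φ = unitLinearIstr hF τ hmt haa δ hA φ') : φ = φ' := by
  obtain ⟨ζ, β, α, hζb, hζ, hα, hφ⟩ := exists_normalForm hF hmt haa hA φ
  obtain ⟨ζ', β', α', hζ'b, hζ', hα', hφ'⟩ := exists_normalForm hF hmt haa hA φ'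
  have hd : degFr F ζ = degFr F ζ' := by
    rw [← degFr_normalForm ζ β (hF.iv_b α hα).2, hφ, ← degFr_unitLinearIstr hF τ hmt haa δ hA φ, h,
      degFr_unitLinearIstr, ← hφ', degFr_normalForm ζ' β' (hF.iv_b α' hα').2]
  have hb : Base F α = Base F α' := by
    rw [← base_normalForm hζb β α, hφ, ← base_unitLinearIstr hF τ hmt haa δ hA φ, h,
      base_unitLinearIstr, ← hφ', base_normalForm hζ'b β' α']
  rw [unitLinearIstr_eq hF τ hmt haa δ hA hζb hζ hα hφ, unitLinearIstr_eq hF τ hmt haa δ hA hζ'b hζ' hα' hφ']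
    at h
  obtain ⟨v, w, hv, hw, hζv, hαw, hx⟩ := normalForm_compare hF hζb hζ hζ'b hζ' hd hα hα' hb h
  rw [← unitLinearPow_unit_mul_mul_unit hF τ hmt haa δ hv hw] at hx
  have hββ' : β = w * β' * v := unitLinearPow_injective hF τ hmt haa δ hδ hx
  rw [← hφ, ← hφ', hββ', endSubmonoid_coe_mul_mul, hζv, hαw]
  simp only [Category.assoc]

/-- **`Ψ` hits every arrow of `C(d)` out of an isotropic object**: if `Div(ψ) ∈ d · Φ(A)` then
`ψ = Ψ(φ)` for some `φ` (normal form `ψ = ζ ; β ; α` with `Div β = Div ψ`, and `β = Ψ_A(β')`).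
[cite: MochizukiFrdI2008, Prop. 2.5(iii) p.50] -/
theorem exists_unitLinearIstr_eq {A B : C} (hA : IsIsotropic F A) {ψ : A ⟶ B}
    (hψ : Div F ψ ∈ imageSubmonoid δ (op (baseObj F A))) :
    ∃ φ : A ⟶ B, unitLinearIstr hF τ hmt haa δ hA φ = ψ := by
  obtain ⟨ζ, β, α, hζb, hζ, hα, h⟩ := exists_normalForm hF hmt haa hA ψ
  obtain ⟨⟨-, hαi⟩, hαl⟩ := hF.iv_b α hα
  have hβ : divHom F A β ∈ imageSubmonoid δ (op (baseObj F A)) := by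
    rw [← div_normalForm hζb hζ.1.2 β hαi hαl, h]; exact hψ
  obtain ⟨β', hβ'⟩ := exists_unitLinearPow_eq hF τ hmt haa δ hβ
  exact ⟨ζ ≫ (β'.1 : A ⟶ A) ≫ α, by
    rw [unitLinearIstr_eq hF τ hmt haa δ hA hζb hζ hα rfl, hβ', h]⟩

end CharacteristicSplitting

end PreFrobenioid

end Literature.AlgebraicGeometry.Frobenioids
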